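import Summits.Ventures.PercRepro.RankLevelSetBiIndepMonoSum
import Summits.Ventures.PercRepro.RankLevelSetBiIndepAvoidSkew

/-! # RankLevelSetBiIndepAvoidNormSkew — THE NORMALIZED AVOID LADDER: (CUM-norm) ON THE MINORS GIVES THE NORMALIZED
CUMULATIVE SKEW OF EVERY AVOID-`y` PROFILE ((AVOID-norm): `b^y_i / C(#E − 1, i) ≤ b^y_j / C(#E − 1, j)` FOR
`i < j`, `i + j ≤ #E − 1`), AND (AVOID-norm) SUMMED OVER THE ELEMENTS IS MONO (night-1 g31; dossier §43.6)

g30's avoid ladder (`RankLevelSetBiIndepAvoidSkew`) shows that the avoid-`y` profile `b^y_k = #{Z ∈ D_k : y ∉ Z}` is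
cumulatively skewed about `(#E − 1)/2` under the cumulative (CX*) of the minors. Under the NORMALIZED hypothesis —
(CUM-norm) on every minor — the same decomposition `b^y = free + absorbing` gives the NORMALIZED statement
`SkewConv.NormSkew (yAvoidCount M y) (#E − 1)` (**`yAvoidCount_normSkew`**): the free part is the bi-independent
profile of `M ／ {y}` on `#E − 1` elements, whose normalized skew is Mono of `M ／ {y}` (`lowFreeAt_normSkew`); the
absorbing part is a sum over the circuits `C ∋ y` of contain profiles of the minors `(M ／ {y}) ＼ {x}` shifted by one
level (`lowAbsorbAt_normSkew`): (CUM-norm) of the minor at `X_C = C ∖ {x, y}` is `NormSkew` of the `j`-indexed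
profile with parameter `#E − 2 − 2#X_C − 1`, the level index shifts it by `#X_C` (**`SkewConv.normSkew_shift`**: a
shift by `t` adds `2t` to the normalized parameter — `C(N + 2, j)·j·(N + 2 − j) = C(N, j − 1)·(N + 2)(N + 1)` and
`i(N + 2 − i) ≤ j(N + 2 − j)`), and the fibre shifts it once more: parameter `#E − 1`. Summing (AVOID-norm) over
the elements (`sum_not_mem_biIndep`: `Σ_y b^y_k = (#E − k)·D_k`) gives Mono of `M` directly
(**`biIndepMono_of_forall_minor_normSkew'`**), a second, normalized route to g30's ladder. (AVOID-norm) is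
census-true on every matroid with ≤ 8 elements and every non-loop (9,342 + 1,009 + … profiles, 0 failures;
mining/night-1/g31/avoidnorm.py). Every declaration has a docstring; imports: the cell's own modules and Mathlib
only. Axioms: standard. -/

namespace PercRepro

namespace SkewConv

open Finset

/-- `C(N + 2, j)·j·(N + 2 − j) = C(N, j − 1)·(N + 2)·(N + 1)` for `1 ≤ j`. -/
lemma choose_two_succ_mul (N j : ℕ) (hj : 1 ≤ j) :
    (N + 2).choose j * j * (N + 2 - j) = N.choose (j - 1) * ((N + 2) * (N + 1)) := by
  obtain ⟨j', rfl⟩ : ∃ j', j = j' + 1 := ⟨j - 1, by omega⟩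
  simp only [Nat.add_sub_cancel]
  -- `(N + 2) · C(N + 1, j') = C(N + 2, j' + 1) · (j' + 1)` and `C(N, j') · (N + 1) = C(N + 1, j') · (N + 1 − j')`
  have h1 := Nat.add_one_mul_choose_eq (N + 1) j'
  have h2 := Nat.choose_mul_succ_eq N j'
  have e : N + 2 - (j' + 1) = N + 1 - j' := by omega
  rw [e]
  calc (N + 2).choose (j' + 1) * (j' + 1) * (N + 1 - j')
      = (N + 1 + 1) * (N + 1).choose j' * (N + 1 - j') := by rw [← h1]
    _ = (N + 2) * ((N + 1).choose j' * (N + 1 - j')) := by ring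
    _ = (N + 2) * (N.choose j' * (N + 1)) := by rw [← h2]
    _ = N.choose j' * ((N + 2) * (N + 1)) := by ring

/-- `i·(N + 2 − i) ≤ j·(N + 2 − j)` for `i ≤ j`, `i + j ≤ N + 2`. -/
lemma mul_sub_le_mul_sub {N i j : ℕ} (hij : i ≤ j) (hsum : i + j ≤ N + 2) :
    i * (N + 2 - i) ≤ j * (N + 2 - j) := by
  obtain ⟨d, rfl⟩ := Nat.exists_eq_add_of_le hij
  have e1 : N + 2 - i = (N + 2 - (i + d)) + d := by omega
  rw [e1]
  calc i * (N + 2 - (i + d) + d) = i * (N + 2 - (i + d)) + i * d := by ring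
    _ ≤ i * (N + 2 - (i + d)) + d * (N + 2 - (i + d)) := by
        apply Nat.add_le_add_left
        rw [Nat.mul_comm]
        exact Nat.mul_le_mul_left d (by omega)
    _ = (i + d) * (N + 2 - (i + d)) := by ring

/-- **A shift by one adds two to the normalized parameter**: `NormSkew a N → NormSkew (shiftSeq a 1) (N + 2)`. -/
lemma normSkew_shift_one {a : ℕ → ℕ} {N : ℕ} (ha : NormSkew a N) : NormSkew (shiftSeq a 1) (N + 2) := by
  intro i j hij hR
  unfold shiftSeq
  rcases Nat.eq_zero_or_pos i with hi0 | hi1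
  · subst hi0
    rw [if_neg (by omega), Nat.zero_mul]
    exact Nat.zero_le _
  rw [if_pos (by omega), if_pos (by omega)]
  have hna := ha (i - 1) (j - 1) (by omega) (by omega)
  have hjN : j ≤ N + 1 := by omega
  have hpos : 0 < i * (N + 2 - i) * (j * (N + 2 - j)) :=
    Nat.mul_pos (Nat.mul_pos hi1 (by omega)) (Nat.mul_pos (by omega) (by omega))
  refine Nat.le_of_mul_le_mul_right (c := i * (N + 2 - i) * (j * (N + 2 - j))) ?_ hpos
  have c1 := choose_two_succ_mul N j (by omega)
  have c2 := choose_two_succ_mul N i hi1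
  have hle := mul_sub_le_mul_sub (N := N) hij.le hR
  calc a (i - 1) * (N + 2).choose j * (i * (N + 2 - i) * (j * (N + 2 - j)))
      = a (i - 1) * ((N + 2).choose j * j * (N + 2 - j)) * (i * (N + 2 - i)) := by ring
    _ = a (i - 1) * (N.choose (j - 1) * ((N + 2) * (N + 1))) * (i * (N + 2 - i)) := by rw [c1]
    _ = (a (i - 1) * N.choose (j - 1)) * ((N + 2) * (N + 1)) * (i * (N + 2 - i)) := by ring
    _ ≤ (a (j - 1) * N.choose (i - 1)) * ((N + 2) * (N + 1)) * (j * (N + 2 - j)) :=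
        Nat.mul_le_mul (Nat.mul_le_mul_right _ hna) hle
    _ = a (j - 1) * (N.choose (i - 1) * ((N + 2) * (N + 1))) * (j * (N + 2 - j)) := by ring
    _ = a (j - 1) * ((N + 2).choose i * i * (N + 2 - i)) * (j * (N + 2 - j)) := by rw [c2]
    _ = a (j - 1) * (N + 2).choose i * (i * (N + 2 - i) * (j * (N + 2 - j))) := by ring

/-- `shiftSeq a (t + 1) = shiftSeq (shiftSeq a t) 1`. -/
lemma shiftSeq_succ (a : ℕ → ℕ) (t k : ℕ) : shiftSeq a (t + 1) k = shiftSeq (shiftSeq a t) 1 k := by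
  unfold shiftSeq
  split_ifs with h1 h2 h3 h3 <;> first | rfl | omega | (congr 1; omega)

/-- **A shift by `t` adds `2t` to the normalized parameter**: `NormSkew a N → NormSkew (shiftSeq a t) (N + 2t)`. -/
lemma normSkew_shift {a : ℕ → ℕ} {N : ℕ} (ha : NormSkew a N) (t : ℕ) : NormSkew (shiftSeq a t) (N + 2 * t) := by
  induction t with
  | zero =>
    refine normSkew_congr ha fun k _ => ?_
    unfold shiftSeq
    rw [if_pos (Nat.zero_le k), Nat.sub_zero]
  | succ t ih =>
    have h1 := normSkew_shift_one ih
    rw [show N + 2 * (t + 1) = N + 2 * t + 2 by ring]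
    exact normSkew_congr h1 fun k _ => (shiftSeq_succ a t k).symm

/-- **(CUM-norm) in the `j`-index gives `NormSkew` with parameter `N − 1`**: the comparisons with `i + j + 1 ≤ N`,
normalized by `C(N, ·)`, imply the same comparisons normalized by `C(N − 1, ·)`. -/
lemma normSkew_of_cumNorm {a : ℕ → ℕ} {N : ℕ}
    (h : ∀ i j : ℕ, i < j → i + j + 1 ≤ N → a i * N.choose j ≤ a j * N.choose i) : NormSkew a (N - 1) := by
  intro i j hij hR
  have h1 := h i j hij (by omega)
  have h2 : N.choose i * (N - 1).choose j ≤ N.choose j * (N - 1).choose i :=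
    chooseRatio_le (Nat.sub_le N 1) hij.le (by omega)
  have hpos : 0 < N.choose i := Nat.choose_pos (by omega)
  refine Nat.le_of_mul_le_mul_left (c := N.choose i) ?_ hpos
  calc N.choose i * (a i * (N - 1).choose j) = a i * (N.choose i * (N - 1).choose j) := by ring
    _ ≤ a i * (N.choose j * (N - 1).choose i) := Nat.mul_le_mul_left _ h2
    _ = (a i * N.choose j) * (N - 1).choose i := by ring
    _ ≤ (a j * N.choose i) * (N - 1).choose i := Nat.mul_le_mul_right _ h1
    _ = N.choose i * (a j * (N - 1).choose i) := by ring

end SkewConv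

open Set Matroid

variable {α : Type} (M : Matroid α) [M.Finite]

/-- **The level-indexed contain profile of a (CUM-norm) matroid is normalized-skew with parameter `#E − 1`**: the
`j`-indexed profile has parameter `#E − 2#X − 1` and the level index shifts it by `#X`. -/
lemma normSkew_biContainCount_of_normSkew (h : BiContainNormSkew M) {X : Set α} (hX : X ⊆ M.E) :
    SkewConv.NormSkew (fun k => biContainCount M X k) (M.E.ncard - 1) := by
  have hXE : X.ncard ≤ M.E.ncard := Set.ncard_le_ncard hX M.ground_finite
  have hj : SkewConv.NormSkew (fun i => minorPairCount M X ∅ i) (M.E.ncard - 2 * X.ncard - 1) := by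
    refine SkewConv.normSkew_of_cumNorm fun i j hij hR => ?_
    have := h X hX i j hij hR
    have hi := biContainCount_eq_minorPairCount M hX (k := X.ncard + i) (by omega)
    have hj' := biContainCount_eq_minorPairCount M hX (k := X.ncard + j) (by omega)
    rw [Nat.add_sub_cancel_left] at hi hj'
    rw [hi, hj'] at this
    exact this
  have hs := SkewConv.normSkew_shift hj X.ncard
  -- `(#E − 2#X − 1) + 2#X ≥ #E − 1` in `ℕ` (equality when `#E ≥ 2#X + 1`, and `2#X ≥ #E − 1` otherwise)
  refine SkewConv.normSkew_congr (SkewConv.normSkew_mono hs (by omega)) fun k _ => ?_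
  unfold SkewConv.shiftSeq
  split_ifs with hk
  · exact (biContainCount_eq_minorPairCount M hX hk).symm
  · exact (biContainCount_eq_zero_of_lt_ncard M (by omega)).symm

/-- **The absorbing avoid-`y` profile is normalized-skew with parameter `#E − 1`** under (CUM-norm) of the minors
`(M ／ {y}) ＼ {x}`: a sum over the circuits `C ∋ y` of level-indexed contain profiles of those minors (parameter
`#E − 3`), each shifted by one level. -/
theorem lowAbsorbAt_normSkew (h : ∀ N : Matroid α, Matroid.IsMinor N M → BiContainNormSkew N) {y : α}
    (hy : M.IsNonloop y) :
    SkewConv.NormSkew (fun k => (lowAbsorbAt M y k).ncard) (M.E.ncard - 1) := by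
  classical
  have hyE := hy.mem_ground
  have hyI : M.Indep {y} := hy.indep
  have hcirc : ∀ C ∈ circuitsThroughAt M y,
      SkewConv.NormSkew (fun k => circuitLowCountAt M y C k) (M.E.ncard - 1) := by
    intro C hC
    rw [mem_circuitsThroughAt] at hC
    obtain ⟨x, hxC, hxy⟩ := exists_mem_circuit_ne M hy hC.1 hC.2
    have hxE : x ∈ M.E := hC.1.subset_ground hxC
    set N := (M.contract {y}).delete {x} with hN
    have hNmin : Matroid.IsMinor N M := ⟨{y}, {x}, rfl⟩
    haveI : N.Finite := by rw [hN]; infer_instance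
    have hx' : x ∈ M.E \ {y} := ⟨hxE, fun h => hxy (Set.mem_singleton_iff.mp h)⟩
    have hNcard : N.E.ncard = M.E.ncard - 2 := by
      rw [hN, minor_ground_eq', Set.ncard_sdiff_singleton_of_mem hx', Set.ncard_sdiff_singleton_of_mem hyE]
      omega
    have hXE : (C \ {y}) \ {x} ⊆ N.E := by
      rw [hN, minor_ground_eq']
      intro z hz
      exact ⟨⟨hC.1.subset_ground hz.1.1, hz.1.2⟩, hz.2⟩
    have hn2 : 2 ≤ M.E.ncard := by
      have := Set.ncard_le_ncard (show {x, y} ⊆ M.E from by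
        intro z hz
        rcases hz with rfl | rfl
        · exact hxE
        · exact hyE) M.ground_finite
      rwa [Set.ncard_pair hxy] at this
    -- the level-indexed contain profile of `N`, parameter `#E − 3`, shifted by one level
    have hα := normSkew_biContainCount_of_normSkew N (h N hNmin) hXE
    rw [hNcard] at hα
    have hshift := SkewConv.normSkew_shift hα 1
    refine SkewConv.normSkew_congr (SkewConv.normSkew_mono hshift (by omega)) fun k _ => ?_
    rcases k with _ | i
    · simp only [SkewConv.shiftSeq]
      rw [if_neg (by omega)]
      symm
      unfold circuitLowCountAt
      have hset : {P : Set α | P ⊆ M.E \ {y} ∧ P.ncard = 0 ∧ C \ {y} ⊆ P ∧ M.Indep P ∧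
          M.Indep (insert y ((M.E \ {y}) \ P))} = ∅ := by
        apply Set.eq_empty_of_forall_notMem
        rintro P ⟨hPE, hP0, hCP, -, -⟩
        have hPe : P = ∅ := (Set.ncard_eq_zero (M.ground_finite.subset (hPE.trans Set.sdiff_subset))).mp hP0
        rw [hPe] at hCP
        exact hCP ⟨hxC, fun h => hxy (Set.mem_singleton_iff.mp h)⟩
      rw [hset, Set.ncard_empty]
    · simp only [SkewConv.shiftSeq, Nat.succ_le_succ_iff, Nat.zero_le, if_true, Nat.add_sub_cancel]
      exact (circuitLowCountAt_eq_biContainCount M hC.1 hC.2 hxC hxy hyI i).symm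
  have hsum := SkewConv.normSkew_sum (circuitsThroughAt M y) (fun C k => circuitLowCountAt M y C k) hcirc
  exact SkewConv.normSkew_congr hsum fun k _ => (ncard_lowAbsorbAt_eq_sum M hyE k).symm

/-- **The free avoid-`y` profile is normalized-skew with parameter `#E − 1`**: it is the bi-independent profile of
`M ／ {y}` (`#E − 1` elements), whose normalized skew is Mono of `M ／ {y}`, which (CUM-norm) on the minors gives. -/
theorem lowFreeAt_normSkew (h : ∀ N : Matroid α, Matroid.IsMinor N M → BiContainNormSkew N) {y : α}
    (hy : M.IsNonloop y) :
    SkewConv.NormSkew (fun k => (lowFreeAt M y k).ncard) (M.E.ncard - 1) := by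
  have hmin : Matroid.IsMinor (M.contract {y}) M := ⟨{y}, ∅, (Matroid.delete_empty _).symm⟩
  haveI : (M.contract {y}).Finite := ⟨M.ground_finite.subset hmin.subset⟩
  have hmono : BiIndepMono (M.contract {y}) :=
    biIndepMono_of_forall_minor_normSkew _ fun N hN => h N (Matroid.IsMinor.trans hN hmin)
  have hcard : (M.contract {y}).E.ncard = M.E.ncard - 1 := by
    rw [Matroid.contract_ground, Set.ncard_sdiff_singleton_of_mem hy.mem_ground]
  have hD := normSkew_biIndepCount_of_mono (M.contract {y}) hmono
  rw [hcard] at hD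
  refine SkewConv.normSkew_congr hD fun k _ => ?_
  simp only [lowFreeAt_eq_biIndep_contract M hy]
  rfl

/-- **(AVOID-norm): THE AVOID-`y` PROFILE IS NORMALIZED-SKEW WITH PARAMETER `#E − 1`** under (CUM-norm) of the minors:
`b^y_i · C(#E − 1, j) ≤ b^y_j · C(#E − 1, i)` for `i < j`, `i + j ≤ #E − 1`. -/
theorem yAvoidCount_normSkew (h : ∀ N : Matroid α, Matroid.IsMinor N M → BiContainNormSkew N) {y : α}
    (hy : M.IsNonloop y) : SkewConv.NormSkew (yAvoidCount M y) (M.E.ncard - 1) := by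
  have := SkewConv.normSkew_add (lowFreeAt_normSkew M h hy) (lowAbsorbAt_normSkew M h hy)
  exact SkewConv.normSkew_congr this fun k _ => (yAvoidCount_eq_free_add_absorb M y k).symm

/-- The avoid-`y` profile of a loop `y` vanishes (a loop kills every bi-independent set). -/
lemma yAvoidCount_eq_zero_of_loop {y : α} (hyE : y ∈ M.E) (hy : ¬ M.Indep {y}) (k : ℕ) :
    yAvoidCount M y k = 0 := by
  unfold yAvoidCount
  have h0 : biContainCount M ∅ k = 0 := biContainCount_eq_zero_of_loop M hyE hy ∅ k
  rw [biContainCount_empty] at h0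
  unfold biIndepCount at h0
  have hsub : {Z ∈ biIndep M k | y ∉ Z} ⊆ biIndep M k := fun Z hZ => hZ.1
  exact Nat.eq_zero_of_le_zero ((Set.ncard_le_ncard hsub (biIndep_finite M k)).trans h0.le)

/-- **(AVOID-norm) for every element** (loops vacuously). -/
theorem yAvoidCount_normSkew_all (h : ∀ N : Matroid α, Matroid.IsMinor N M → BiContainNormSkew N) {y : α}
    (hyE : y ∈ M.E) : SkewConv.NormSkew (yAvoidCount M y) (M.E.ncard - 1) := by
  by_cases hy : M.Indep {y}
  · exact yAvoidCount_normSkew M h (Matroid.indep_singleton.mp hy)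
  · exact SkewConv.normSkew_congr (SkewConv.normSkew_zero _) fun k _ =>
      (yAvoidCount_eq_zero_of_loop M hyE hy k).symm

/-- **The avoid profiles summed over the elements are normalized-skew with parameter `#E − 1`**:
`k ↦ (#E − k)·D_k`. -/
theorem normSkew_sum_avoid (h : ∀ N : Matroid α, Matroid.IsMinor N M → BiContainNormSkew N) :
    SkewConv.NormSkew (fun k => (M.E.ncard - k) * biIndepCount M k) (M.E.ncard - 1) := by
  have hsum := SkewConv.normSkew_sum M.ground_finite.toFinset (fun y k => yAvoidCount M y k)
    fun y hy => yAvoidCount_normSkew_all M h (M.ground_finite.mem_toFinset.mp hy)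
  exact SkewConv.normSkew_congr hsum fun k _ => sum_not_mem_biIndep M k

/-- **MONO FROM (CUM-norm) ON THE MINORS, THROUGH (AVOID-norm)**: `(#E − i)·D_i·C(#E − 1, j) ≤ (#E − j)·D_j·C(#E − 1, i)`
is `D_i·C(#E, j) ≤ D_j·C(#E, i)` (`C(#E, k) = C(#E − 1, k)·#E/(#E − k)`). -/
theorem biIndepMono_of_forall_minor_normSkew' (h : ∀ N : Matroid α, Matroid.IsMinor N M → BiContainNormSkew N) :
    BiIndepMono M := by
  apply biIndepMono_of_normSkew
  have hs := normSkew_sum_avoid M h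
  intro i j hij hR
  -- `C(n, k) · (n − k) = C(n − 1, k) · n` for `k < n`
  have key : ∀ k, k < M.E.ncard →
      M.E.ncard.choose k * (M.E.ncard - k) = (M.E.ncard - 1).choose k * M.E.ncard := by
    intro k hk
    obtain ⟨n', hn'⟩ : ∃ n', M.E.ncard = n' + 1 := ⟨M.E.ncard - 1, by omega⟩
    rw [hn', Nat.add_sub_cancel]
    exact (Nat.choose_mul_succ_eq n' k).symm
  rcases Nat.lt_or_ge (i + j) M.E.ncard with hlt | hge
  · have h1 := hs i j hij (by omega)
    have ki := key i (by omega)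
    have kj := key j (by omega)
    have hpos : 0 < (M.E.ncard - i) * (M.E.ncard - j) := Nat.mul_pos (by omega) (by omega)
    refine Nat.le_of_mul_le_mul_right (c := (M.E.ncard - i) * (M.E.ncard - j)) ?_ hpos
    calc biIndepCount M i * M.E.ncard.choose j * ((M.E.ncard - i) * (M.E.ncard - j))
        = (M.E.ncard.choose j * (M.E.ncard - j)) * (biIndepCount M i * (M.E.ncard - i)) := by ring
      _ = ((M.E.ncard - 1).choose j * M.E.ncard) * (biIndepCount M i * (M.E.ncard - i)) := by rw [kj]
      _ = M.E.ncard * ((M.E.ncard - i) * biIndepCount M i * (M.E.ncard - 1).choose j) := by ring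
      _ ≤ M.E.ncard * ((M.E.ncard - j) * biIndepCount M j * (M.E.ncard - 1).choose i) :=
          Nat.mul_le_mul_left _ h1
      _ = ((M.E.ncard - 1).choose i * M.E.ncard) * (biIndepCount M j * (M.E.ncard - j)) := by ring
      _ = (M.E.ncard.choose i * (M.E.ncard - i)) * (biIndepCount M j * (M.E.ncard - j)) := by rw [ki]
      _ = biIndepCount M j * M.E.ncard.choose i * ((M.E.ncard - i) * (M.E.ncard - j)) := by ring
  · -- `i + j = #E`: the symmetry `D_j = D_{#E − j} = D_i` and `C(#E, j) = C(#E, i)`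
    have hj : j = M.E.ncard - i := by omega
    have hsym := biIndepCount_compl M i (by omega)
    rw [hj, hsym, Nat.choose_symm (by omega)]

end PercRepro
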